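import Mathlib
import HarnessLib
import Summits.NavierStokesRegularity.NavierStokesRegularity.Theorems.PoloidalWindowDoorLrcModEntireTwistingTHOscUniversalWeightCurvature
import Summits.NavierStokesRegularity.NavierStokesRegularity.Theorems.PoloidalWindowDoorLrcModEntireTwistingTHOscAncientLiouville
import Summits.NavierStokesRegularity.NavierStokesRegularity.Theorems.PoloidalWindowDoorLrcModEntireTwistingTHOscAncientLiouvilleDecay

/-!
# Item `LrcModEntire` (stmt-NavierStokesRegularity-20428), CLASS road to `stub_twistingTHGerm` — the ancient Liouville theorem for (OSC) in similarity variables WITHOUT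
# BOUNDEDNESS: polynomial growth in `ξ` (uniformly in `τ`) suffices, for every compression constant (explicit weight ∘ port-2's decay theorem)

Cell ns-regularity-ideate, LEAD ns-poloidal-K2-p3 g13 (`--supports stmt-NavierStokesRegularity-20428`).  Composition BY NAME of this seat's explicit universal weight
`…OscUniversalWeightCurvature.exists_universalWeight₂` (Gaussian decay of `w, w′, w″`) with ns-k2-port-2 g3's (K-d) `…OscAncientLiouvilleDecay.eq_zero_of_majorant`
(polynomially bounded non-negative eternal subsolutions with an integrable majorant against the weight vanish) and `…eq_zero_of_massBound_frequently`.
* `weight_poly_integrable` — the explicit weight has `(1+ξ²)^n·(|w|+|w′|+|w″|)` integrable for every `n` (Gaussian beats polynomial; port-2's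
  `integrable_one_add_sq_pow_mul_gaussian`);
* `eq_zero_of_ancient_oscSubsolution_polyGrowth` — **`_anyK` with the boundedness `Q ≤ c` REPLACED by the polynomial growth `|Q(τ,ξ)| ≤ C(1+ξ²)^k`** (the same
  `C, k` as the derivative bounds): every such non-negative eternal classical subsolution of `Q_τ + ½∂_ξ((ξ+S)Q) ≤ Q_ξξ`, `|S| ≤ A`, vanishes — no weight hypothesis.
READING (memo OSC-LIOUVILLE-g13 §5quinquies/§5septies): the size part of the wall weakens from «√(−t)·osc_plane W bounded» to «√(−t)·osc_plane W(t,·,z) ≤ C(1 + z²/(−t))^k»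
— polynomial growth in the similarity height — uniformly in t ≤ t₀; the slope may inflate polynomially ACROSS heights but not in time at fixed similarity height.

WHAT THIS IS NOT: not a claim about Navier–Stokes regularity and not the stub (bears_on LADDER-NS N0, item 20428 / crux 19708; both OPEN).
-/

noncomputable section

-- the summit and its single sub-problem share the name (CONVENTIONS §1), as in every Theorems file
set_option linter.dupNamespace false

namespace Summit.NavierStokesRegularity.NavierStokesRegularity.Theorems.PoloidalWindowDoorLrcModEntireTwistingTHOscLiouvillePoly

open Set Filter Topology MeasureTheory
open Summit.NavierStokesRegularity.NavierStokesRegularity.Theorems.PoloidalWindowDoorLrcModEntireTwistingTHOscUniversalWeightCurvature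
open Summit.NavierStokesRegularity.NavierStokesRegularity.Theorems.PoloidalWindowDoorLrcModEntireTwistingTHOscAncientLiouville
open Summit.NavierStokesRegularity.NavierStokesRegularity.Theorems.PoloidalWindowDoorLrcModEntireTwistingTHOscAncientLiouvilleDecay

/-- **Gaussian decay of `w, w′, w″` ⇒ polynomial-weighted integrability** of `|w| + |w′| + |w″|`, for every exponent `n`. -/
theorem weight_poly_integrable {w : ℝ → ℝ} {κ Cw : ℝ} (hw : ContDiff ℝ 2 w) (hκ : 0 < κ)
    (hdec : ∀ ξ, |w ξ| ≤ Cw * Real.exp (-κ * ξ ^ 2)) (hdec' : ∀ ξ, |deriv w ξ| ≤ Cw * Real.exp (-κ * ξ ^ 2))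
    (hdec'' : ∀ ξ, |deriv (deriv w) ξ| ≤ Cw * Real.exp (-κ * ξ ^ 2)) (n : ℕ) :
    Integrable fun ξ => (1 + ξ ^ 2) ^ n * (|w ξ| + |deriv w ξ| + |deriv (deriv w) ξ|) := by
  have hmaj := (integrable_one_add_sq_pow_mul_gaussian hκ n).const_mul (3 * Cw)
  have hwc : Continuous w := hw.continuous
  have hw1 : ContDiff ℝ 1 (deriv w) := by
    have h2 : ContDiff ℝ (1 + 1) w := by rwa [one_add_one_eq_two]
    exact h2.deriv'
  have hw'c : Continuous (deriv w) := hw1.continuous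
  have hw''c : Continuous (deriv (deriv w)) := hw1.continuous_deriv le_rfl
  refine hmaj.mono' ((((continuous_const.add (continuous_pow 2)).pow n).mul
    ((hwc.abs.add hw'c.abs).add hw''c.abs)).aestronglyMeasurable) (Eventually.of_forall fun ξ => ?_)
  have hP : 0 ≤ (1 + ξ ^ 2) ^ n := by positivity
  rw [Real.norm_eq_abs, abs_of_nonneg (by positivity)]
  have h3 : |w ξ| + |deriv w ξ| + |deriv (deriv w) ξ| ≤ 3 * Cw * Real.exp (-κ * ξ ^ 2) := by
    linarith [hdec ξ, hdec' ξ, hdec'' ξ]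
  calc (1 + ξ ^ 2) ^ n * (|w ξ| + |deriv w ξ| + |deriv (deriv w) ξ|)
      ≤ (1 + ξ ^ 2) ^ n * (3 * Cw * Real.exp (-κ * ξ ^ 2)) := mul_le_mul_of_nonneg_left h3 hP
    _ = 3 * Cw * ((1 + ξ ^ 2) ^ n * Real.exp (-κ * ξ ^ 2)) := by ring

/-- **ANCIENT LIOUVILLE FOR (OSC), POLYNOMIAL GROWTH, EVERY COMPRESSION.**  Let `Q ≥ 0` with `Q(τ,·) ∈ C²`, time derivative `Qt` (continuous in `ξ`), and the POLYNOMIAL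
bounds `|Q|, |Qt|, |Q_ξ|, |Q_ξξ| ≤ C(1+ξ²)^k` (uniformly in `τ`); let `S(τ,·) ∈ C¹`, `|S| ≤ A` (`A > 0`), `|S_ξ| ≤ C(1+ξ²)^k`.  If `Qt + ½∂_ξ((ξ+S)Q) ≤ Q_ξξ` on `ℝ × ℝ`, then
`Q ≡ 0`.  (No boundedness of `Q`, no weight hypothesis, no «K < 1/2».) -/
theorem eq_zero_of_ancient_oscSubsolution_polyGrowth {Q Qt S : ℝ → ℝ → ℝ} {A C : ℝ} {k : ℕ} (hA : 0 < A)
    (hQ2 : ∀ τ, ContDiff ℝ 2 (Q τ)) (hQt : ∀ τ ξ, HasDerivAt (fun τ' => Q τ' ξ) (Qt τ ξ) τ) (hQtc : ∀ τ, Continuous (Qt τ))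
    (h0 : ∀ τ ξ, 0 ≤ Q τ ξ) (hQb : ∀ τ ξ, |Q τ ξ| ≤ C * (1 + ξ ^ 2) ^ k)
    (hQtb : ∀ τ ξ, |Qt τ ξ| ≤ C * (1 + ξ ^ 2) ^ k) (hQ1b : ∀ τ ξ, |deriv (Q τ) ξ| ≤ C * (1 + ξ ^ 2) ^ k)
    (hQ2b : ∀ τ ξ, |deriv (deriv (Q τ)) ξ| ≤ C * (1 + ξ ^ 2) ^ k)
    (hS : ∀ τ, ContDiff ℝ 1 (S τ)) (hSA : ∀ τ ξ, |S τ ξ| ≤ A) (hS1b : ∀ τ ξ, |deriv (S τ) ξ| ≤ C * (1 + ξ ^ 2) ^ k)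
    (hsub : ∀ τ ξ, Qt τ ξ + (1 / 2 : ℝ) * deriv (fun ξ => (ξ + S τ ξ) * Q τ ξ) ξ ≤ deriv (deriv (Q τ)) ξ) :
    ∀ τ ξ, Q τ ξ = 0 := by
  obtain ⟨γ, κ, Cw, hγ, hκ, hCw, w, hw2, _heven, hpos, _hmono, hineq, hdec, hdec', hdec''⟩ := exists_universalWeight₂ hA
  have hWint := weight_poly_integrable hw2 hκ hdec hdec' hdec'' (2 * k + 1)
  -- the polynomial majorant `G = C(1+ξ²)^k` is integrable against the Gaussian weight
  have hGw : Integrable fun ξ => C * (1 + ξ ^ 2) ^ k * w ξ := by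
    have hmaj := (integrable_one_add_sq_pow_mul_gaussian hκ k).const_mul (|C| * Cw)
    have hwc : Continuous w := hw2.continuous
    refine hmaj.mono' (((continuous_const.mul ((continuous_const.add (continuous_pow 2)).pow k)).mul hwc).aestronglyMeasurable)
      (Eventually.of_forall fun ξ => ?_)
    have hP : 0 ≤ (1 + ξ ^ 2) ^ k := by positivity
    rw [Real.norm_eq_abs, abs_mul, abs_mul, abs_of_nonneg hP]
    calc |C| * (1 + ξ ^ 2) ^ k * |w ξ| ≤ |C| * (1 + ξ ^ 2) ^ k * (Cw * Real.exp (-κ * ξ ^ 2)) :=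
          mul_le_mul_of_nonneg_left (hdec ξ) (by positivity)
      _ = |C| * Cw * ((1 + ξ ^ 2) ^ k * Real.exp (-κ * ξ ^ 2)) := by ring
  exact eq_zero_of_majorant hw2 hpos hγ hineq hWint hQ2 hQt hQtc h0 hQb hQtb hQ1b hQ2b hS hSA hS1b hsub
    (fun τ ξ => (le_abs_self _).trans (hQb τ ξ)) hGw

end Summit.NavierStokesRegularity.NavierStokesRegularity.Theorems.PoloidalWindowDoorLrcModEntireTwistingTHOscLiouvillePoly
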